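import Mathlib
import Summits.RiemannHypothesis.RiemannHypothesis.Theorems.JensenPolynomialsDefs
import Summits.RiemannHypothesis.RiemannHypothesis.Theorems.JensenPolynomialsXiGorttwCoeffSmallTableAlgebra
import Literature.NumberTheory.LFunctions.XiMoments

/-! # JensenHermiteExpansion — S-T0: GORTTW's frame identity `c₀ = 1, c₁ = c₂ = 0` and the Hermite reconstruction
`J̃^{d,n} = Σ_j c_{d,n,j}·H_{d−j}(X/2)` for ANY real sequence `γ` with `Δ(M)² > 0`, `γ(M), γ(M−1) ≠ 0` (`gorttwFrame_holds`).
RH-FREE, ξ-free (polynomial algebra only): the fixed-range Hermite coordinate functional `hcN`, Hermite inversion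
(`exists_hermite_expansion`, `sum_hermiteCoord_mul_gorzHermite`), the coefficients of the normalised Jensen polynomial
(`coeff_gorttwNormalised_top/pred/pred_pred`; the coefficient formula itself is the eng seat's `CoeffTable.coeff_gorttwNormalised`).  Verbatim port of HOME `rh-jensen-theory/JensenTargets.lean` v4.5 §8.7 (cell rh-jensen, HUMAN RULING
D-0040; one file per source section, D-0064(4)); supports the route item `JensenPolynomials.SignTestBlueprintWindow`
(the blueprint file `JensenSignTestBlueprint` imports this one).  Nothing here bears on the zeros of `ζ`. -/

noncomputable section
set_option linter.dupNamespace false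

open Polynomial Finset
open scoped Nat

namespace Summit.RiemannHypothesis.RiemannHypothesis.Theorems.JensenPolynomials

open Literature.NumberTheory.LFunctions
open CoeffTable (coeff_gorttwNormalised natDegree_gorttwNormalised_le)

/-- Support **S-T0 (ξ-free; GORTTW Lemma 2.2 + Hermite inversion, for ANY real sequence with `Δ(M)² > 0`,
`γ(M), γ(M−1) ≠ 0`)**: the frame is normal — `c_{d,n,0} = 1`, `c_{d,n,1} = c_{d,n,2} = 0` — and `J̃^{d,n}`
is its own Hermite expansion. Bookkeeping (shift kills `X^{d−1}`, scale matches `X^{d−2}`);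
PROVED for every real sequence below (`gorttwFrame_holds`). -/
def GorttwFrame (γ : ℕ → ℝ) : Prop :=
  ∀ d n : ℕ, 1 ≤ d → 0 < gorttwDeltaSq γ (n + d) → γ (n + d) ≠ 0 → γ (n + d - 1) ≠ 0 →
    gorttwCoeff γ d n 0 = 1 ∧ gorttwCoeff γ d n 1 = 0 ∧ gorttwCoeff γ d n 2 = 0 ∧
      gorttwNormalised γ d n = ∑ j ∈ range (d + 1), C (gorttwCoeff γ d n j) * gorzHermite (d - j)

/-- fixed-range Hermite coordinate functional (range `N`). -/
def hcN (N : ℕ) (p : ℝ[X]) (k : ℕ) : ℝ :=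
  ∑ i ∈ range (N + 1), p.coeff (k + 2 * i) * (((k + 2 * i)! : ℝ) / ((i ! : ℝ) * (k ! : ℝ)))

/-- `Σ_{i ≤ s} (−1)^{s−i}/((s−i)! i!) = [s = 0]`. -/
theorem alt_sum_inv_factorial (s : ℕ) :
    ∑ i ∈ range (s + 1), (-1 : ℝ) ^ (s - i) / (((s - i)! : ℝ) * (i ! : ℝ)) =
      if s = 0 then 1 else 0 := by
  have h := Int.alternating_sum_range_choose (n := s)
  have h' : ∑ i ∈ range (s + 1), ((-1 : ℝ) ^ i * (s.choose i : ℝ)) = if s = 0 then 1 else 0 := by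
    have := congrArg (fun z : ℤ => (z : ℝ)) h
    simpa using this
  -- reflect and divide by s!
  have hs : (s ! : ℝ) ≠ 0 := by positivity
  have key : ∀ i ∈ range (s + 1), (-1 : ℝ) ^ (s - i) / (((s - i)! : ℝ) * (i ! : ℝ)) =
      (1 / (s ! : ℝ)) * ((-1 : ℝ) ^ (s - i) * (s.choose (s - i) : ℝ)) := by
    intro i hi
    have hi' : i ≤ s := Nat.lt_succ_iff.mp (mem_range.mp hi)
    have hc : (s.choose (s - i) : ℝ) * (((s - i)! : ℝ) * (i ! : ℝ)) = (s ! : ℝ) := by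
      rw [Nat.choose_symm hi']
      have := Nat.choose_mul_factorial_mul_factorial hi'
      have h2 : (s.choose i : ℝ) * (i ! : ℝ) * ((s - i)! : ℝ) = (s ! : ℝ) := by exact_mod_cast this
      linear_combination h2
    have hne : (((s - i)! : ℝ) * (i ! : ℝ)) ≠ 0 := by positivity
    have hc' : (s.choose (s - i) : ℝ) = (s ! : ℝ) / (((s - i)! : ℝ) * (i ! : ℝ)) := by
      rw [eq_div_iff hne]; exact hc
    rw [hc']
    field_simp
  rw [sum_congr rfl key, ← mul_sum]
  have hrefl : ∑ i ∈ range (s + 1), (-1 : ℝ) ^ (s - i) * (s.choose (s - i) : ℝ) =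
      ∑ i ∈ range (s + 1), (-1 : ℝ) ^ i * (s.choose i : ℝ) := by
    have := sum_range_reflect (fun i => (-1 : ℝ) ^ i * (s.choose i : ℝ)) (s + 1)
    simpa [Nat.add_sub_cancel] using this
  rw [hrefl, h']
  split_ifs with h0
  · subst h0; simp
  · simp

/-- Orthogonality: the fixed-range coordinate functional recovers the Hermite basis. -/
theorem hcN_gorzHermite (N j k : ℕ) (hj : j ≤ N) :
    hcN N (gorzHermite j) k = if j = k then 1 else 0 := by
  unfold hcN
  rcases lt_or_ge j k with hlt | hle
  · rw [if_neg (by omega)]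
    refine sum_eq_zero fun i hi => ?_
    rw [coeff_gorzHermite, if_neg (by omega), zero_mul]
  · obtain ⟨m, rfl⟩ := Nat.exists_eq_add_of_le hle
    rcases Nat.even_or_odd m with ⟨s, hs⟩ | hodd
    · subst hs
      have hsN : s ≤ N := by omega
      -- restrict the sum to `range (s+1)`
      rw [← sum_subset (Finset.range_mono (by omega : s + 1 ≤ N + 1))]
      swap
      · intro i hi his
        have hi' : s < i := by
          simp only [mem_range, not_lt] at his hi; omega
        rw [coeff_gorzHermite, if_neg (by omega), zero_mul]
      have key : ∀ i ∈ range (s + 1),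
          (gorzHermite (k + (s + s))).coeff (k + 2 * i) * (((k + 2 * i)! : ℝ) / ((i ! : ℝ) * (k ! : ℝ))) =
          (((k + (s + s))! : ℝ) / (k ! : ℝ)) * ((-1 : ℝ) ^ (s - i) / (((s - i)! : ℝ) * (i ! : ℝ))) := by
        intro i hi
        have hi' : i ≤ s := Nat.lt_succ_iff.mp (mem_range.mp hi)
        rw [coeff_gorzHermite, if_pos (by omega),
          show k + (s + s) - (k + 2 * i) = 2 * (s - i) by omega, expNegSqCoeff_two_mul]
        have h1 : ((-1 : ℝ)) ^ (2 * (s - i)) = 1 := by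
          rw [pow_mul]; simp
        rw [h1, mul_one]
        have hk : (k ! : ℝ) ≠ 0 := by positivity
        have hi2 : (i ! : ℝ) ≠ 0 := by positivity
        have hsi : ((s - i)! : ℝ) ≠ 0 := by positivity
        have hki : ((k + 2 * i)! : ℝ) ≠ 0 := by positivity
        field_simp
      rw [sum_congr rfl key, ← mul_sum, alt_sum_inv_factorial]
      split_ifs with h0 h1 h1
      · subst h0
        have hk : (k ! : ℝ) ≠ 0 := by positivity
        simp [hk]
      · exact absurd h0 (by omega)
      · exact absurd h1 (by omega)
      · simp
    · rw [if_neg (by intro h; obtain ⟨t, ht⟩ := hodd; omega)]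
      refine sum_eq_zero fun i hi => ?_
      rw [coeff_gorzHermite]
      split_ifs with h
      · have hodd' : Odd (k + m - (k + 2 * i)) := by
          rw [show k + m - (k + 2 * i) = m - 2 * i by omega]
          exact Nat.Odd.sub_even (by omega) hodd (even_two_mul i)
        rw [expNegSqCoeff_of_odd hodd']; simp
      · simp

/-- `hermiteCoord` with the summation range enlarged to any `N ≥ natDegree p`. -/
theorem hermiteCoord_eq_hcN (p : ℝ[X]) {N : ℕ} (hN : p.natDegree ≤ N) (k : ℕ) :
    hermiteCoord p k = hcN N p k := by
  unfold hermiteCoord hcN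
  apply sum_subset (Finset.range_mono (by omega))
  intro i hi his
  have : p.natDegree < k + 2 * i := by simp only [mem_range, not_lt] at hi his; omega
  rw [coeff_eq_zero_of_natDegree_lt this, zero_mul]

/-- Linearity of the fixed-range functional on Hermite combinations. -/
theorem hcN_sum (N d : ℕ) (b : ℕ → ℝ) (k : ℕ) :
    hcN N (∑ j ∈ range (d + 1), C (b j) * gorzHermite j) k =
      ∑ j ∈ range (d + 1), b j * hcN N (gorzHermite j) k := by
  unfold hcN
  simp only [finsetSum_coeff, coeff_C_mul, sum_mul, mul_sum]
  rw [sum_comm]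
  exact sum_congr rfl fun j _ => sum_congr rfl fun i _ => by ring

/-- Every polynomial of degree `≤ d` is a combination of `gorzHermite 0, …, gorzHermite d`. -/
theorem exists_hermite_expansion (d : ℕ) : ∀ p : ℝ[X], p.natDegree ≤ d →
    ∃ b : ℕ → ℝ, p = ∑ j ∈ range (d + 1), C (b j) * gorzHermite j := by
  induction d with
  | zero =>
    intro p hp
    refine ⟨fun _ => p.coeff 0, ?_⟩
    rw [sum_range_one, gorzHermite_zero, mul_one]
    exact eq_C_of_natDegree_le_zero hp
  | succ d ih =>
    intro p hp
    have htop : (gorzHermite (d + 1)).coeff (d + 1) = 1 := by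
      simpa [natDegree_gorzHermite] using (monic_gorzHermite (d + 1)).coeff_natDegree
    have hq : (p - C (p.coeff (d + 1)) * gorzHermite (d + 1)).natDegree ≤ d := by
      rw [natDegree_le_iff_coeff_eq_zero]
      intro m hm
      rw [coeff_sub, coeff_C_mul]
      rcases eq_or_lt_of_le (Nat.succ_le_of_lt hm) with h | h
      · rw [← h, htop, mul_one, sub_self]
      · have h1 : p.coeff m = 0 := coeff_eq_zero_of_natDegree_lt (lt_of_le_of_lt hp h)
        have h2 : (gorzHermite (d + 1)).coeff m = 0 :=
          coeff_eq_zero_of_natDegree_lt (by rw [natDegree_gorzHermite]; exact h)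
        rw [h1, h2, mul_zero, sub_zero]
    obtain ⟨b', hb'⟩ := ih _ hq
    refine ⟨fun j => if j = d + 1 then p.coeff (d + 1) else b' j, ?_⟩
    rw [sum_range_succ]
    beta_reduce
    rw [if_pos rfl]
    have hrest : ∑ j ∈ range (d + 1), C (if j = d + 1 then p.coeff (d + 1) else b' j) * gorzHermite j =
        ∑ j ∈ range (d + 1), C (b' j) * gorzHermite j := by
      refine sum_congr rfl fun j hj => ?_
      rw [if_neg (by simp only [mem_range] at hj; omega)]
    rw [hrest, ← hb']
    ring

/-- **Hermite reconstruction**: `p = Σ_{j ≤ d} hermiteCoord p j · gorzHermite j` whenever `natDegree p ≤ d`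
(the inversion `X^m = m! Σ gorzHermite (m−2i)/(i!(m−2i)!)` [DLMF 18.18.20] in coordinate form). -/
theorem sum_hermiteCoord_mul_gorzHermite (p : ℝ[X]) {d : ℕ} (hp : p.natDegree ≤ d) :
    ∑ j ∈ range (d + 1), C (hermiteCoord p j) * gorzHermite j = p := by
  obtain ⟨b, hb⟩ := exists_hermite_expansion d p hp
  have hcoord : ∀ j ∈ range (d + 1), hermiteCoord p j = b j := by
    intro j hj
    rw [hermiteCoord_eq_hcN p hp, hb, hcN_sum]
    rw [sum_congr rfl fun i hi => by
      rw [hcN_gorzHermite d i j (Nat.lt_succ_iff.mp (mem_range.mp hi))]]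
    simp only [mul_ite, mul_one, mul_zero]
    rw [sum_ite_eq' (range (d + 1)) j b, if_pos hj]
  rw [sum_congr rfl fun j hj => by rw [hcoord j hj], ← hb]

/-- Top coefficient: `[X^d] J̃^{d,n} = 1`. -/
theorem coeff_gorttwNormalised_top (γ : ℕ → ℝ) (d n : ℕ) (hΔ : 0 < gorttwDeltaSq γ (n + d))
    (hγ : γ (n + d) ≠ 0) (hγ1 : γ (n + d - 1) ≠ 0) : (gorttwNormalised γ d n).coeff d = 1 := by
  rw [coeff_gorttwNormalised, sum_range_succ, sum_eq_zero]
  swap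
  · intro j hj; rw [if_neg (by simp only [mem_range] at hj; omega), mul_zero]
  rw [zero_add, if_pos le_rfl]
  simp only [Nat.choose_self, Nat.cast_one, one_mul, Nat.sub_self, pow_zero, mul_one]
  have hr : gorttwR γ (n + d) ≠ 0 := by unfold gorttwR; exact div_ne_zero hγ1 hγ
  have hΔ' : gorttwDelta γ (n + d) ≠ 0 := (Real.sqrt_pos.mpr hΔ).ne'
  unfold gorttwA
  rw [mul_pow]
  field_simp

/-- Next coefficient: `[X^{d−1}] J̃^{d,n} = 0` (the shift `−r` centres the frame), `d = e + 1`. -/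
theorem coeff_gorttwNormalised_pred (γ : ℕ → ℝ) (e n : ℕ) (hγ : γ (n + (e + 1)) ≠ 0) :
    (gorttwNormalised γ (e + 1) n).coeff e = 0 := by
  rw [coeff_gorttwNormalised, sum_range_succ, sum_range_succ, sum_eq_zero]
  swap
  · intro j hj; rw [if_neg (by simp only [mem_range] at hj; omega), mul_zero]
  rw [zero_add, if_pos (by omega), if_pos (by omega), Nat.choose_succ_self_right]
  simp only [Nat.choose_self, Nat.cast_one, one_mul, Nat.sub_self, pow_zero, mul_one,
    show e + 1 - e = 1 by omega, pow_one]
  unfold gorttwR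
  rw [show n + (e + 1) - 1 = n + e by omega]
  push_cast
  field_simp
  ring

/-- The coefficient `[X^{d−2}] J̃^{d,n} = −d(d−1)` (the scale `Δ` matches `H_d`), `d = e + 2`. -/
theorem coeff_gorttwNormalised_pred_pred (γ : ℕ → ℝ) (e n : ℕ) (hΔ : 0 < gorttwDeltaSq γ (n + (e + 2)))
    (hγ : γ (n + (e + 2)) ≠ 0) (hγ1 : γ (n + (e + 2) - 1) ≠ 0) :
    (gorttwNormalised γ (e + 2) n).coeff e = -(((e : ℝ) + 2) * ((e : ℝ) + 1)) := by
  rw [coeff_gorttwNormalised, sum_range_succ, sum_range_succ, sum_range_succ, sum_eq_zero]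
  swap
  · intro j hj; rw [if_neg (by simp only [mem_range] at hj; omega), mul_zero]
  rw [zero_add, if_pos (by omega), if_pos (by omega), if_pos (by omega)]
  have hc2 : ((e + 2).choose e : ℝ) = ((e : ℝ) + 2) * ((e : ℝ) + 1) / 2 := by
    rw [Nat.choose_symm_of_eq_add (rfl : e + 2 = e + 2), Nat.cast_choose_two]; push_cast; ring
  have hc1 : ((e + 2).choose (e + 1) : ℝ) = (e : ℝ) + 2 := by
    rw [Nat.choose_succ_self_right]; push_cast; ring
  have hc0 : ((e + 1).choose e : ℝ) = (e : ℝ) + 1 := by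
    rw [Nat.choose_succ_self_right]; push_cast; ring
  rw [hc2, hc1, hc0]
  simp only [Nat.choose_self, Nat.cast_one, one_mul, Nat.sub_self, pow_zero, mul_one,
    show e + 1 - e = 1 by omega, show e + 2 - e = 2 by omega, pow_one]
  rw [show n + (e + 2) - 1 = n + (e + 1) by omega] at hγ1
  unfold gorttwA gorttwR
  rw [show n + (e + 2) - 1 = n + (e + 1) by omega]
  set Δ := gorttwDelta γ (n + (e + 2)) with hΔdef
  have hΔsq : Δ ^ 2 = (1 - γ (n + e) * γ (n + (e + 2)) / γ (n + (e + 1)) ^ 2) / 2 := by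
    rw [hΔdef]; unfold gorttwDelta
    rw [Real.sq_sqrt hΔ.le]
    unfold gorttwDeltaSq windowSeqDown
    rw [show n + (e + 2) - 2 = n + e by omega, show n + (e + 2) - 1 = n + (e + 1) by omega]
    norm_num
  have hΔ' : Δ ≠ 0 := by rw [hΔdef]; exact (Real.sqrt_pos.mpr hΔ).ne'
  have hγe : γ (n + e) = γ (n + (e + 1)) ^ 2 * (1 - 2 * Δ ^ 2) / γ (n + (e + 2)) := by
    rw [hΔsq]; field_simp; ring
  rw [hγe]
  have hne : γ (n + (e + 2)) * (γ (n + (e + 1)) / γ (n + (e + 2))) ^ (e + 2) * Δ ^ (e + 2) ≠ 0 :=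
    mul_ne_zero (mul_ne_zero hγ (pow_ne_zero _ (div_ne_zero hγ1 hγ))) (pow_ne_zero _ hΔ')
  rw [inv_mul_eq_div, div_eq_iff hne]
  simp only [mul_pow, div_pow]
  field_simp
  ring

/-- **Support S-T0 PROVED (ξ-free; any real sequence)**: GORTTW's frame is normal and `J̃^{d,n}` is its own
Hermite expansion. -/
theorem gorttwFrame_holds (γ : ℕ → ℝ) : GorttwFrame γ := by
  intro d n hd hΔ hγ hγ1
  have hdeg := natDegree_gorttwNormalised_le γ d n
  have htop := coeff_gorttwNormalised_top γ d n hΔ hγ hγ1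
  have hzero : ∀ m, d < m → (gorttwNormalised γ d n).coeff m = 0 := fun m hm =>
    coeff_eq_zero_of_natDegree_lt (lt_of_le_of_lt hdeg hm)
  -- c₀ = 1
  have hc0 : gorttwCoeff γ d n 0 = 1 := by
    unfold gorttwCoeff
    rw [Nat.sub_zero, hermiteCoord_eq_hcN _ hdeg]
    unfold hcN
    rw [sum_range_succ', sum_eq_zero]
    swap
    · intro i hi; rw [hzero _ (by omega), zero_mul]
    rw [mul_zero, add_zero, htop, one_mul, zero_add]
    have : (d ! : ℝ) ≠ 0 := by positivity
    rw [Nat.factorial_zero, Nat.cast_one, one_mul, div_self this]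
  -- c₁ = 0
  have hc1 : gorttwCoeff γ d n 1 = 0 := by
    unfold gorttwCoeff
    rw [hermiteCoord_eq_hcN _ hdeg]
    unfold hcN
    refine sum_eq_zero fun i hi => ?_
    rcases i with _ | i
    · obtain ⟨e, rfl⟩ : ∃ e, d = e + 1 := ⟨d - 1, by omega⟩
      rw [show e + 1 - 1 = e by omega, mul_zero, add_zero, coeff_gorttwNormalised_pred γ e n hγ, zero_mul]
    · rw [hzero _ (by omega), zero_mul]
  refine ⟨hc0, hc1, ?_, ?_⟩
  · -- c₂ = 0
    rcases Nat.lt_or_ge d 2 with hd2 | hd2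
    · obtain rfl : d = 1 := by omega
      simpa [gorttwCoeff] using hc1
    · obtain ⟨e, rfl⟩ : ∃ e, d = e + 2 := ⟨d - 2, by omega⟩
      unfold gorttwCoeff
      rw [show e + 2 - 2 = e by omega, hermiteCoord_eq_hcN _ hdeg]
      unfold hcN
      rw [sum_range_succ', sum_range_succ', sum_eq_zero]
      swap
      · intro i hi; rw [hzero _ (by omega), zero_mul]
      rw [zero_add, mul_zero, add_zero, show e + 2 * (0 + 1) = e + 2 by ring, htop,
        coeff_gorttwNormalised_pred_pred γ e n hΔ hγ hγ1]
      have he : (e ! : ℝ) ≠ 0 := by positivity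
      rw [Nat.factorial_succ (e + 1), Nat.factorial_succ e]
      push_cast
      field_simp
      ring
  · -- reconstruction
    unfold gorttwCoeff
    have h := sum_range_reflect (fun k => C (hermiteCoord (gorttwNormalised γ d n) k) * gorzHermite k) (d + 1)
    simp only [Nat.add_sub_cancel] at h
    rw [h, sum_hermiteCoord_mul_gorzHermite _ hdeg]

end Summit.RiemannHypothesis.RiemannHypothesis.Theorems.JensenPolynomials

end
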